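import Summits.QuantumFields.YangMills.Theorems.SwapVirialDeficitZeroModeGroupFourSmallBallLogLimit
import Summits.QuantumFields.YangMills.Theorems.SwapVirialDeficitLaplaceAbelianLog
import HarnessLib

/-!
# Exact zero-mode rung K4 in LAPLACE form: `β³·∫ e^{−β·G₄} dHaar⁴ / log β → (w₄/2)·Γ(4)` for FOUR pairwise nearly commuting letters
# (LEAD ym-line-sfw-p2 g93 «sum ↔ Laplace form of the zero-mode blocks»; free-hands support of ⟨stmt-QuantumFields-24197⟩; asked by w3 g63 11:51Z)

The logarithmic Abelian glue ✓`tendsto_laplace_abelian_log` (w2 g56) turns the `t⁶·log(1/t)` small-ball law of four pairwise nearly commuting `SU(2)`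
letters ✓`tendsto_haar_nearlyCommuting_div_log` (fcl-p3 g44 parts I–XI, w3 g63 part XII: `Haar⁴(N₄(t))/(t⁶log(1/t)) → w₄`) into the Laplace side:
with `G₄ = (max_{μ,ν} ‖[q_μ,q_ν]‖)²` (`commMax4Sq`, `{G₄ ≤ s} = N₄(√s)` ✓`setOf_commMax4Sq_le`) and `log(1/√s) = ½·log s⁻¹`,
★★★ `tendsto_laplace_nearlyCommuting_four` — `β³·∫_{SU(2)⁴} e^{−β·G₄} dHaar⁴ / log β → (w₄/2)·Γ(3 + 1)` as `β → ∞`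
(`w₄ = π·coneConst⁴·vol³(T(0,0,0))/64 > 0`, ✓`w4_pos`): the zero-mode block of the femto ring of four commuting-up-to-`t` letters carries a LOGARITHM
on the Laplace side too.
HONEST LABEL: finite-dimensional real analysis (plan-level zero-mode rung); NOT ⟨24197⟩/⟨24497⟩; the Yang–Mills mass gap is NOT proved; no summit is proved
by a line.  Width seat ym-line-sfw-p2-w2 g56 (cell ym-idea-1, free hands; own crux ⟨22884⟩ blocked-on ⟨19935⟩), `--supports stmt-QuantumFields-24197`.
THEOREMS ONLY, standard axioms, 0 `sorry`.  References: [cite: GonzalezarroyoAltes1988]; [cite: Vanbaal2001]; [cite: Luscher1983, §2]; [folklore].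
-/

set_option autoImplicit false

noncomputable section

open MeasureTheory Set Real Filter
open scoped ENNReal Topology
open Quaternion Literature.MathematicalPhysics.QuantumLattice
open scoped Quaternion
open Literature.MathematicalPhysics.QuantumFieldTheory (haarProbability)
open Literature.MathematicalPhysics.QuantumFieldTheory.Balaban1983to89.T4HaarSU2Translate (continuous_su2Quat)
open Summit.QuantumFields.YangMills.Theorems.SwapTwistDeficit.ToronLog (nearlyCommuting coneConst)
open Summit.QuantumFields.YangMills.Theorems.SwapVirialDeficit.ZeroModeGroup (twoScaleSet4 tendsto_haar_nearlyCommuting_div_log w4_pos)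

attribute [local instance] Literature.Analysis.FluidPDE.Tao2016.quatMeasurableSpace
  Literature.Analysis.FluidPDE.Tao2016.quatBorelSpace

namespace Summit.QuantumFields.YangMills.Theorems.SwapVirialDeficit.Abelian

/-- The max of the (sixteen, with trivial diagonal and symmetric repetitions) commutator norms of four letters. [folklore] -/
def commMax4 (C : Fin 4 → Matrix.specialUnitaryGroup (Fin 2) ℂ) : ℝ :=
  ⨆ p : Fin 4 × Fin 4, ‖su2Quat (C p.1) * su2Quat (C p.2) - su2Quat (C p.2) * su2Quat (C p.1)‖

/-- The squared max commutator `G₄ = commMax4²`. [folklore] -/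
def commMax4Sq (C : Fin 4 → Matrix.specialUnitaryGroup (Fin 2) ℂ) : ℝ := commMax4 C ^ 2

/-- `commMax4 ≥ 0`. [folklore] -/
theorem commMax4_nonneg (C : Fin 4 → Matrix.specialUnitaryGroup (Fin 2) ℂ) : 0 ≤ commMax4 C := Real.iSup_nonneg fun _ => norm_nonneg _

/-- `commMax4` is measurable. [folklore] -/
theorem measurable_commMax4 : Measurable commMax4 := by
  have hq : ∀ i : Fin 4, Continuous fun C : Fin 4 → Matrix.specialUnitaryGroup (Fin 2) ℂ => su2Quat (C i) :=
    fun i => continuous_su2Quat.comp (continuous_apply i)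
  unfold commMax4
  exact Measurable.iSup fun p => (((hq _).mul (hq _)).sub ((hq _).mul (hq _))).norm.measurable

/-- `G₄` is measurable. [folklore] -/
theorem measurable_commMax4Sq : Measurable commMax4Sq := measurable_commMax4.pow_const 2

/-- `{G₄ ≤ s} = N₄(√s)` for `s ≥ 0`. [folklore] -/
theorem setOf_commMax4Sq_le {s : ℝ} (hs : 0 ≤ s) : {C | commMax4Sq C ≤ s} = nearlyCommuting (Real.sqrt s) := by
  ext C
  simp only [mem_setOf_eq, commMax4Sq, nearlyCommuting]
  rw [← Real.le_sqrt (commMax4_nonneg C) hs, commMax4, ciSup_le_iff (Finite.bddAbove_range _)]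
  constructor
  · intro h μ ν; exact h (μ, ν)
  · intro h p; exact h p.1 p.2

/-- ★★★ **FOUR PAIRWISE NEARLY COMMUTING LETTERS IN LAPLACE FORM** (logarithmic Abelian image of ✓`tendsto_haar_nearlyCommuting_div_log`):
`β³·∫_{SU(2)⁴} e^{−β·G₄} dHaar⁴ / log β → (w₄/2)·Γ(3 + 1)` as `β → ∞`, `G₄ = (max commutator norm)²`,
`w₄ = π·coneConst⁴·vol³(twoScaleSet4 0 0 0)/64 > 0`.  HONEST LABEL: plan-level zero-mode rung; NOT ⟨24197⟩; the Yang–Mills mass gap is NOT proved.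
[cite: GonzalezarroyoAltes1988] [cite: Vanbaal2001] -/
theorem tendsto_laplace_nearlyCommuting_four :
    Tendsto (fun β : ℝ => β ^ (3:ℝ) * (∫ C, Real.exp (-(β * commMax4Sq C))
        ∂(Measure.pi fun _ : Fin 4 => haarProbability (Matrix.specialUnitaryGroup (Fin 2) ℂ))) / Real.log β) atTop
      (𝓝 ((Real.pi * coneConst ^ 4 * ((((volume : Measure ℍ).prod (volume : Measure ℍ)).prod (volume : Measure ℍ)) (twoScaleSet4 0 0 0)).toReal / 64 / 2) *
        Real.Gamma ((3:ℝ) + 1))) := by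
  set μ4 := Measure.pi fun _ : Fin 4 => haarProbability (Matrix.specialUnitaryGroup (Fin 2) ℂ) with hμ4
  set w4 : ℝ := Real.pi * coneConst ^ 4 * ((((volume : Measure ℍ).prod (volume : Measure ℍ)).prod (volume : Measure ℍ)) (twoScaleSet4 0 0 0)).toReal / 64
    with hw4
  have hT := tendsto_haar_nearlyCommuting_div_log
  -- the small-ball law in the variable `s = t²`
  have hsqrt : Tendsto (fun s : ℝ => Real.sqrt s) (𝓝[>] (0:ℝ)) (𝓝[>] (0:ℝ)) := by
    refine tendsto_nhdsWithin_iff.2 ⟨?_, ?_⟩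
    · have h := (Real.continuous_sqrt.tendsto (0:ℝ)).mono_left (nhdsWithin_le_nhds (s := Ioi (0:ℝ)))
      rwa [Real.sqrt_zero] at h
    · filter_upwards [self_mem_nhdsWithin] with s hs using Real.sqrt_pos.2 hs
  have hlim : Tendsto (fun s : ℝ => (μ4 {C | commMax4Sq C ≤ s}).toReal / (s ^ (3:ℝ) * Real.log s⁻¹)) (𝓝[>] (0:ℝ)) (𝓝 (w4 / 2)) := by
    have h2 := (hT.comp hsqrt).div_const 2
    refine h2.congr' ?_
    filter_upwards [Ioo_mem_nhdsGT zero_lt_one] with s hs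
    simp only [Function.comp_apply]
    rw [setOf_commMax4Sq_le hs.1.le]
    have e6 : Real.sqrt s ^ 6 = s ^ (3:ℝ) := by
      rw [Real.sqrt_eq_rpow, ← Real.rpow_natCast, ← Real.rpow_mul hs.1.le]; norm_num
    have elog : Real.log (1 / Real.sqrt s) = Real.log s⁻¹ / 2 := by
      rw [one_div, Real.log_inv, Real.log_inv, Real.log_sqrt hs.1.le]; ring
    rw [e6, elog]
    have hlogpos : 0 < Real.log s⁻¹ := Real.log_pos (one_lt_inv_iff₀.2 ⟨hs.1, hs.2⟩)
    have hs3 : 0 < s ^ (3:ℝ) := Real.rpow_pos_of_pos hs.1 _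
    rw [hμ4]
    field_simp
  have h := tendsto_laplace_abelian_log μ4 measurable_commMax4Sq (fun C => sq_nonneg _) (by norm_num : (0:ℝ) < 3) hlim
  rw [hw4] at h
  exact h

end Summit.QuantumFields.YangMills.Theorems.SwapVirialDeficit.Abelian

end
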